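import Literature.NumberTheory.GaloisRepresentations.IdeleTruncatedSLocalInjectivity
import Literature.NumberTheory.GaloisRepresentations.IdeleBarKSInflationAssembly
import HarnessLib

/-!
# The degree-`0` input [Hom-mono] of the permutation dévissage DISCHARGED (a `G_S`-morphism into `Ī_S` is
# determined by its idèle projections — -w6's uniqueness half of Harari Prop. 17.26), the dévissage with the
# finite-type hypothesis it needs, and hypothesis (Λ2) in the consumer's binder shape

Topic `NumberTheory/GaloisRepresentations`; namespace `Literature.NumberTheory.GaloisRepresentations.IdeleReadout`.
Theorems only; NO named fact, no `sorry`, no instance, no notation; number fields in `Type`.  Sequel of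
`IdeleTruncatedSLocalInjectivity` (bsd-eis -w4 g20, E4c: `idLocMap`, `idLocMap_injective_two_of_inputs` from FIVE
displayed inputs) and of -w6 g11's `IdeleBarKSInflationAssembly` (`exists_galLayer_insideKS_forall_ρ_eq`,
**`hom_ext_of_ideleProjection_sharp_eq`**: a `G_S`-morphism `f : X ⟶ Ī_S` out of a layer-trivialised `X` is determined
by the values `π_v (f x)` at `v ∈ S` and at the infinite places).

* §1 **`idLocMap_zero_injective`** — [Hom-mono]: for `X ∈ C_{G_S}` of finite type over `ℤ`, the degree-`0` localisation
  map `Ext⁰(X, Ī_S) → ∏_{w ∣ S ∪ ∞} Ext⁰(φ_w^* X, K̄_wˣ)` is injective (E1 `locMap_mk₀` + `Ext.mk₀_bijective` + -w6's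
  uniqueness; the `w`-component of `[f]` at `x` IS `π_w (f x)` by `rfl`).
* §2 `locMap_injective_two_of_permutation_fg` — E4a §5's dévissage with its degree-`0` injectivity hypothesis asked
  only for FINITE-TYPE `N` (all that the proof uses: the second kernel is finitely generated, E4a `moduleFinite_kernel`).
* §3 **`idLocMap_injective_two_of_inputs'`** — E4c's theorem with FOUR displayed inputs: [P1-mono], [P1-epi-local],
  [P2-mono] (-w3 g18, E3) and [P0-epi] for `m = 1` (open); [Hom-mono] is now proved.
* §4 **`eq_zero_of_forall_inr_eq_zero`** — hypothesis (Λ2) of `RestrictedExt.exists_cmp_comp_extClass_eq_of_mem_shaRestricted`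
  in its binder shape, from injectivity of `idLocMap K S A 2`, injective comparisons at the finite places of `S` (the
  divisible comparison `Ext²_{C_{Γ_{K_v}}}(φ_v^* A, K̄_vˣ) ≅ H²(K_v, ·)`, -w7 g13) and the vanishing of the archimedean
  components (`K` totally complex).

HONEST FRAMING: bookkeeping around one uniqueness theorem; the remaining displayed inputs are quoted, not proved; no
case of Poitou–Tate duality and nothing about BSD is proved here.  Lane «PT-Ш-S-TC» of crux
`stmt-BirchSwinnertonDyer-19032` (cell bsd-eis, seat bsd-line-x1-p1-w4 gen 20), file E4d.  AI formalisation, established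
only by the kernel check.

## References
* D. Harari, *Galois Cohomology and Class Field Theory*, Universitext (2020), Prop. 17.26 (proof: uniqueness of the
  idèle-valued homomorphism), §17.5 Prop. 17.25. [Harari2020]
* J. S. Milne, *Arithmetic Duality Theorems*, 2nd ed. (2006), I Lemma 4.13, I Thm. 4.10 (a) (proof, p. 58). [MilneADT2006]
-/

noncomputable section

open NumberField IsDedekindDomain Field CategoryTheory CategoryTheory.Limits CategoryTheory.Abelian
open Literature.Algebra.Homology Literature.Algebra.Homology.DiscreteRep
open scoped Classical

namespace Literature.NumberTheory.GaloisRepresentations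

namespace IdeleReadout

open IdeleClassBar

variable (K : Type) [Field K] [NumberField K] (S : Finset (HeightOneSpectrum (𝓞 K)))

/-! ## §1 [Hom-mono]: the degree-`0` localisation map is injective on finite-type objects -/

/-- **[Hom-mono]**: for `X ∈ C_{G_S}` finitely generated over `ℤ`, `idLocMap K S X 0 : Ext⁰(X, Ī_S) →
∏_{w ∣ S ∪ ∞} Ext⁰(φ_w^* X, K̄_wˣ)` is injective — a `G_S`-morphism `X ⟶ Ī_S` is determined by its idèle projections at
the places of `S` and at infinity (-w6's `hom_ext_of_ideleProjection_sharp_eq`, with the trivialising layer of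
`exists_galLayer_insideKS_forall_ρ_eq`). [cite: Harari2020, Prop. 17.26 (proof)][cite: MilneADT2006, I Lemma 4.13 (proof)] -/
theorem idLocMap_zero_injective
    (X : DiscreteRepCat ℤ (GaloisGroupUnramifiedOutside K (↑S : Set (HeightOneSpectrum (𝓞 K)))))
    (hX : letI : Module ℤ X.obj.V := X.obj.hV2; Module.Finite ℤ X.obj.V) :
    Function.Injective (idLocMap K S X 0) := by
  obtain ⟨E, -, hXE⟩ := exists_galLayer_insideKS_forall_ρ_eq X hX
  intro f g hfg
  obtain ⟨f₀, rfl⟩ := (Ext.mk₀_bijective _ _).2 f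
  obtain ⟨g₀, rfl⟩ := (Ext.mk₀_bijective _ _).2 g
  have key : ∀ w : OverS K S, (locFun K S w).map f₀ ≫ locQ K S w = (locFun K S w).map g₀ ≫ locQ K S w := fun w => by
    apply (Ext.mk₀_bijective _ _).1
    have h := congrFun hfg w
    rwa [ExtLocalization.locMap_mk₀, ExtLocalization.locMap_mk₀] at h
  rw [hom_ext_of_ideleProjection_sharp_eq E hXE (f := f₀) (g := g₀) (fun v hv x => ?_) (fun u x => ?_)]
  · exact congrArg (fun e => e.hom.hom x) (key ⟨Sum.inr v, hv⟩)
  · exact congrArg (fun e => e.hom.hom x) (key ⟨Sum.inl u, trivial⟩)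

/-! ## §2 The dévissage with a finite-type degree-`0` hypothesis -/

section Devissage

universe w' v' u' t

-- door-c4's convention (`DiscreteRepFreePresentation`, `DiscreteRepPermutationPresentation`): prefer the
-- representation's own `ℤ`-module structure on `X.obj.V` for the linear algebra of the presentation.
attribute [local instance 10000] Rep.hV2

variable {Γ : Type} [Group Γ] [TopologicalSpace Γ] [IsTopologicalGroup Γ]
  (U : Subgroup Γ) [hUn : U.Normal] (hU : IsOpen (U : Set Γ)) [U.FiniteIndex]
  {ι' : Type t} {D : ι' → Type u'} [∀ i, Category.{v'} (D i)] [∀ i, Abelian (D i)]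
  [∀ i, HasExt.{w'} (D i)]
  (L : ∀ i, DiscreteRepCat ℤ Γ ⥤ D i) [∀ i, (L i).Additive] [∀ i, PreservesFiniteLimits (L i)]
  [∀ i, PreservesFiniteColimits (L i)]
  {B : DiscreteRepCat ℤ Γ} {Y : ∀ i, D i} (q : ∀ i, (L i).obj B ⟶ Y i)

/-- **E4a's dévissage with the degree-`0` injectivity asked only on finite-type `N`** (the proof applies it to the
second kernel, which is finitely generated — E4a `moduleFinite_kernel`). [cite: MilneADT2006, I Lemma 4.13, I Thm. 4.10 (a) (proof, p. 58)] -/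
theorem locMap_injective_two_of_permutation_fg (A : DiscreteRepCat ℤ Γ) [Finite A.obj.V]
    (hUA : ∀ u : Γ, u ∈ U → ∀ a : A.obj.V, A.obj.ρ u a = a)
    (h0epi : ∀ m : ℕ, Function.Surjective
      (ExtLocalization.locMap L q ((coindD ℤ U hU).obj (triv (k := ℤ) (Γ := ↥U) (Fin m → ℤ))) 0))
    (h0mono : ∀ N : DiscreteRepCat ℤ Γ, (letI : Module ℤ N.obj.V := N.obj.hV2; Module.Finite ℤ N.obj.V) →
      Function.Injective (ExtLocalization.locMap L q N 0))
    (h1mono : ∀ m : ℕ, Function.Injective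
      (ExtLocalization.locMap L q ((coindD ℤ U hU).obj (triv (k := ℤ) (Γ := ↥U) (Fin m → ℤ))) 1))
    (h1epi : ∀ m : ℕ, Function.Surjective
      (ExtLocalization.locMap L q ((coindD ℤ U hU).obj (triv (k := ℤ) (Γ := ↥U) (Fin m → ℤ))) 1))
    (h2mono : ∀ m : ℕ, Function.Injective
      (ExtLocalization.locMap L q ((coindD ℤ U hU).obj (triv (k := ℤ) (Γ := ↥U) (Fin m → ℤ))) 2)) :
    Function.Injective (ExtLocalization.locMap L q A 2) := by
  obtain ⟨m, g, hg⟩ := exists_surjective_fin_of_finite A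
  have hS := coindPresSC_shortExact U hU A hUA g hg
  obtain ⟨m', ⟨e⟩⟩ := exists_linearEquiv_fin_kernel U hU A hUA g
  have hS' := coindPresSC_shortExact U hU (kernel (coindPresHom U hU A hUA g))
    (kernel_ρ_apply_eq_of_mem U hU A hUA g) e.symm.toLinearMap e.symm.surjective
  exact ExtLocalization.locMap_injective_of_twoStep L q hS hS' (zero_add 1).symm rfl
    (h0epi m') (h0mono _ (moduleFinite_kernel U hU _ _ _)) (h1mono m') (h1epi m) (h2mono m)

end Devissage

/-! ## §3 The main theorem with FOUR displayed inputs -/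

/-- **Injectivity of `Ext²_{G_S}(A, Ī_S) → ∏_{w ∣ S ∪ ∞} Ext²_{Γ_{K_w}}(φ_w^* A, K̄_wˣ)` for finite `A`** from
[P1-mono], [P1-epi-local], [P2-mono] (bsd-eis -w3 g18's shapes) and [P0-epi] for `m = 1`; [Hom-mono] is §1.
[cite: MilneADT2006, I Lemma 4.13, I Thm. 4.10 (a) (proof, p. 58)][cite: Harari2020, §17.5 Prop. 17.25, Prop. 17.26 (proof)] -/
theorem idLocMap_injective_two_of_inputs'
    (A : DiscreteRepCat ℤ (GaloisGroupUnramifiedOutside K (↑S : Set (HeightOneSpectrum (𝓞 K))))) [Finite A.obj.V]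
    (U : Subgroup (GaloisGroupUnramifiedOutside K (↑S : Set (HeightOneSpectrum (𝓞 K))))) [hUn : U.Normal]
    (hU : IsOpen (U : Set (GaloisGroupUnramifiedOutside K (↑S : Set (HeightOneSpectrum (𝓞 K)))))) [U.FiniteIndex]
    (hUA : ∀ u : GaloisGroupUnramifiedOutside K (↑S : Set (HeightOneSpectrum (𝓞 K))), u ∈ U →
      ∀ a : A.obj.V, A.obj.ρ u a = a)
    (P1mono : ∀ y : Ext (triv (k := ℤ) (Γ := ↥U) ℤ) ((resD ℤ U).obj (truncIdeleBarD K S)) 1, y = 0)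
    (P1epi : ∀ (w : OverS K S) (z : Ext (triv (k := ℤ) (Γ := ↥(U.comap (decompMapPlaceS K S w.1))) ℤ)
      ((resD ℤ (U.comap (decompMapPlaceS K S w.1))).obj (unitsD (Place.Completion w.1))) 1), z = 0)
    (P2mono : ∀ y : Ext (triv (k := ℤ) (Γ := ↥U) ℤ) ((resD ℤ U).obj (truncIdeleBarD K S)) 2,
      (∀ (w : OverS K S) (t : DoubleCosets (decompMapPlaceS K S w.1) U),
        (y.mapExactFunctor (resDHom ℤ (conjHom (decompMapPlaceS K S w.1) U (dcRep (decompMapPlaceS K S w.1) U t))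
          (continuous_conjHom (decompMapPlaceS K S w.1) (continuous_decompMapPlaceS K S w.1) U
            (dcRep (decompMapPlaceS K S w.1) U t)))).comp
          (Ext.mk₀ (conjCoeff (decompMapPlaceS K S w.1) (continuous_decompMapPlaceS K S w.1) U
            (truncIdeleBarD K S) (unitsD (Place.Completion w.1)) (locQ K S w) (dcRep (decompMapPlaceS K S w.1) U t)
            (k := ℤ))) (add_zero 2) = 0) → y = 0)
    (P0epi : Function.Surjective (idLocMap K S ((coindD ℤ U hU).obj (triv (k := ℤ) (Γ := ↥U) ℤ)) 0)) :
    Function.Injective (idLocMap K S A 2) := by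
  haveI hVf : ∀ w : OverS K S, (U.comap (decompMapPlaceS K S w.1)).FiniteIndex :=
    fun w => finiteIndex_comap (decompMapPlaceS K S w.1) U
  refine locMap_injective_two_of_permutation_fg U hU (locFun K S) (locQ K S) A hUA ?_
    (fun N hN => idLocMap_zero_injective K S N hN) ?_ ?_ ?_
  · exact fun m => locMap_surjective_coindD_fin U hU (locFun K S) (locQ K S) 0 P0epi m
  · intro m
    refine locMap_injective_coindD_fin U hU (locFun K S) (locQ K S) 1 (fun x x' _ => ?_) m
    have h0 : ∀ z : Ext ((coindD ℤ U hU).obj (triv (k := ℤ) (Γ := ↥U) ℤ)) (truncIdeleBarD K S) 1, z = 0 :=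
      fun z => (extCoindResAddEquiv U hU _ _ 1).injective ((P1mono _).trans (map_zero _).symm)
    rw [h0 x, h0 x']
  · intro m y
    refine ⟨0, ?_⟩
    rw [map_zero]
    funext w
    exact (ext_one_locFun_coindD_eq_zero U hU w (P1epi w) m (y w)).symm
  · intro m
    refine locMap_injective_coindD_fin U hU (locFun K S) (locQ K S) 2 ?_ m
    rw [injective_iff_map_eq_zero]
    intro x hx
    have hSh : ExtAdjunction.extAdjunctionMap (coindResAdj U hU) (triv (k := ℤ) (Γ := ↥U) ℤ)
        (truncIdeleBarD K S) 2 x = 0 := by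
      refine P2mono _ fun w t => ?_
      rw [← locComponent_eq (decompMapPlaceS K S w.1) (continuous_decompMapPlaceS K S w.1) U hU ℤ
        (truncIdeleBarD K S) (unitsD (Place.Completion w.1)) (locQ K S w) 2 t x]
      exact locComponent_eq_zero_of_eq_zero U hU w ℤ 2 x (congrFun hx w) t
    exact (injective_iff_map_eq_zero _).1
      (ExtAdjunction.extAdjunctionMap_bijective (coindResAdj U hU) (triv (k := ℤ) (Γ := ↥U) ℤ)
        (truncIdeleBarD K S) 2).1 x hSh

/-! ## §4 (appended) The shape consumed by `PoitouTateRestrictedShaTwoLocalCriterion`: hypothesis (Λ2) from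
injectivity of `idLocMap`, an injective comparison at the finite places and archimedean vanishing -/

section Glue

variable {K S}

/-- **(Λ2) in the consumer's binder shape.**  Let `Λ v hv := (cmpv v hv) ∘ (w ↦ idLocMap K S A 2 · ⟨inr v, hv⟩)` be the
local maps at the finite places `v ∈ S`, built from the `Sum.inr v`-components of the localisation map and INJECTIVE
comparisons `cmpv v hv : Ext²_{C_{Γ_{K_v}}}(φ_v^* A, K̄_vˣ) →+ T v` (the divisible comparison `≅ H²(K_v, Hom(A, K̄ˣ))`,
bsd-eis -w7 g13).  If the archimedean components of degree `2` vanish identically (`K` totally complex: `Γ_{K_w}` is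
trivial) and `idLocMap K S A 2` is injective (`idLocMap_injective_two_of_inputs`), then a class all of whose `Λ v hv`
vanish is zero — verbatim hypothesis `hΛ2` of `RestrictedExt.exists_cmp_comp_extClass_eq_of_mem_shaRestricted`.
[cite: MilneADT2006, I Lemma 4.13, I Thm. 4.10 (a) (proof, p. 58)][cite: Harari2020, §17.5 Prop. 17.25] -/
theorem eq_zero_of_forall_inr_eq_zero
    {A : DiscreteRepCat ℤ (GaloisGroupUnramifiedOutside K (↑S : Set (HeightOneSpectrum (𝓞 K))))}
    {T : HeightOneSpectrum (𝓞 K) → Type*} [∀ v, AddCommGroup (T v)]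
    (cmpv : ∀ (v : HeightOneSpectrum (𝓞 K)) (hv : v ∈ S),
      Ext ((locFun K S ⟨Sum.inr v, hv⟩).obj A) (unitsD (Place.Completion (Sum.inr v : Place K))) 2 →+ T v)
    (hcmpv : ∀ v hv, Function.Injective (cmpv v hv))
    (harch : ∀ (u : InfinitePlace K)
      (z : Ext ((locFun K S ⟨Sum.inl u, trivial⟩).obj A) (unitsD (Place.Completion (Sum.inl u : Place K))) 2), z = 0)
    (hinj : Function.Injective (idLocMap K S A 2)) (z : Ext A (truncIdeleBarD K S) 2)
    (hz : ∀ (v : HeightOneSpectrum (𝓞 K)) (hv : v ∈ S), cmpv v hv (idLocMap K S A 2 z ⟨Sum.inr v, hv⟩) = 0) :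
    z = 0 := by
  apply (injective_iff_map_eq_zero _).1 hinj
  funext w
  obtain ⟨w, hw⟩ := w
  cases w with
  | inl u => exact harch u _
  | inr v => exact (injective_iff_map_eq_zero _).1 (hcmpv v hw) _ (hz v hw)

end Glue

end IdeleReadout

end Literature.NumberTheory.GaloisRepresentations

end
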